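import Summits.QuantumFields.BalabanUV.T4Continuum.Support.B13AvgCorrEml
import Literature.Analysis.SpecialFunctions.LogFDeriv
import Mathlib.Analysis.Calculus.MeanValue

/-!
# B13AvgCorrEmlVariation — row NE5, J-avg-reg SECOND ORDER (owner R60 l.24769 ∕ INTENT g39-d l.24783 ∕ dagwriter Q52 l.24813; memo
# `t4/T4-EST-NE5-JAVG-SECOND.md` v1 (S5) ∕ §4 P1-c), brick «σ-L4 ∕ EML LIPSCHITZ ON THE GUARD» — THE ONE-DIFFERENCE TWIN OF κ-L4 `B13AvgCorrEml`:
# TWO FAMILIES OF (0.4) LOOP VARIABLES ON THE SMALL-FIELD GUARD THAT ARE `δ`-CLOSE HAVE `exp[mean log]` CORRECTION FACTORS THAT ARE `(9∕4)·δ`-CLOSE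

Cell `pub-balaban`, unit `b2b-balaban-t4-ne5-formalise-leaf-06` (NE5 formalisation swarm, leaf prover 06, gen 22; CLAIM + INTENT journal l.25051).
Summits-side NEW WORK under the LEAN PLACEMENT RULE: [folklore] Banach-algebra calculus on OUR objects `MatrixLog.mlog`, `ExpMeanLog.eml`,
`ExpMeanLog.expMeanLogSU`, `BlockAveraging.Small ∕ corr ∕ loopHol`; 0 `def`, no `Prop`-valued fact minted, nothing printed asserted, no citation tag.
HONEST FRAMING: rung (B)+1 of the FINITE-VOLUME T⁴ programme — NOT infinite volume, NOT a mass gap, NOT the Clay problem, NOT a proof of NE5 (NOT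
PRINTED; GAPS G-t4-U3-1); nothing of [Balaban1985Averaging] Props 5–10 ∕ [Balaban1985BackgroundPropagators] (3.36) ∕ [Balaban1987RG1] is instantiated
or discharged — the loop-variable bounds `ρ` (κ-chain) and the loop-variable VARIATION bound `δ` (σ-L1 «Stokes for differences» × σ-L2) stay DISPLAYED
hypotheses of every theorem below.  HONEST DEPENDENCY (cell, verbatim): continuum YM on T⁴ ⇐ BetaPertH ∧ nine spine estimates (0/9 proved);
BetaPertH ⇐ (D1) ∧ (D4) ∧ CAP+tail; G-an2-4 gates asym, D1 and NE2/3/4.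

WHY.  The second-order letters (ℓ2)(ℓ4) of row NE2's window need, besides β″, a first-DIFFERENCE letter for the one-step correction factors of
Bałaban's (0.4) average of record along the averaging tower (memo (C1): `‖ι corr(U_i, c + e_ν) − ι corr(U_i, c)‖·ℓ³ ≤ κ₁`).  σ-L1 ∕ σ-L2 bound the
variation of the LOOP VARIABLES (`dist1 (loopHol U′ c′ i * (loopHol U c i)⁻¹) ≤ δ`); THIS FILE turns it into a variation of the correction factor
`corr expMeanLogSU = exp[mean log]` — the «Lipschitz form of κ-L4's analytic mean» that (S5) invokes.  The tree's
`BlockAveragingEMLAnalyticMean.norm_eml_add_sub_eml_le` (`‖eml (U+V) − eml U‖ ≤ 12‖V‖` for `‖U − 1‖ ≤ 1∕6`, `‖V‖ ≤ 1∕24`) does not cover the guard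
(`dist1 < δ_N ≤ 1∕3`, differences not a priori `≤ 1∕24`); the mean-value inequality with the tree's derivative bounds `‖D log(1+x)‖ ≤ (1 − ‖x‖)⁻¹`
(`LogFDeriv`) and `‖D exp(Z)‖ ≤ e^{‖Z‖}` (`ExpFDeriv`) gives the Lipschitz constant `(1 − ρ)⁻²` on the whole closed polydisc of radius `ρ < 1`, i.e.
`9∕4` at the tree's radius `1∕3`.

WHAT (0 def, [folklore] throughout).  §1 generic: `norm_mlog_sub_mlog_le` (`log` is `(1−ρ)⁻¹`-Lipschitz on `‖X − 1‖ ≤ ρ < 1`),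
`norm_exp_sub_exp_le_of_norm_le` (`exp` is `e^r`-Lipschitz on `‖Z‖ ≤ r`), **`norm_eml_sub_eml_le`: `‖eml U′ − eml U‖ ≤ ‖U′ − U‖∕(1−ρ)²`**, componentwise
and linear (`9∕4`, `ρ ≤ 1∕3`) forms.  §2: the CURRENCY BRIDGE `norm_map_sub_map_eq_dist1` (`‖ι a − ι b‖ = dist1 (a * b⁻¹)` for a unitary realisation with
`‖ι g − 1‖ = dist1 g` — σ-L1's quotient currency IS the matrix-difference currency of (C1)), `dist1_mul_inv_eq_norm_sub` (`SU(N)`), and two families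
under `expMeanLogSU.E` ∕ `.avg` on the guard.  §3 block step, two (field, bond) pairs `(U, c)`, `(U′, c′)` at any two levels (covers the translate
instance `c′ = c + e_ν` AND the two-field instance `U′ = U ∘ τ`): `dist1_corr_mul_inv_le_of_small`, **END `dist1_corr_mul_inv_le`** (`ρ < δ_N`:
`dist1 (corr U′ c′ * (corr U c)⁻¹) ≤ 9∕4 * δ`), its `δ∕(1−ρ)²` and matrix-difference forms, and the THRESHOLD-FREE companion **`dist1_corr_mul_inv_le_add`:
`≤ 9∕4 * δ + 3 * ρ² ∕ δ_N` for EVERY `ρ`**.  HONEST NOTE: unlike κ-L4's END, a one-difference bound linear in `δ` ALONE cannot be threshold-free — the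
total extension `corr` jumps from `E(W)` to `1` across `dist1 = δ_N`; the consumer keeps `κ₀ < δ_N = min(1∕3, π∕N)` as a displayed smallness of the
window or carries the guard-jump term.  §4 SCALED currency (`ℓ ≥ 1` a free real — instantiate `ℓ := lev P.L k` or `L^(K−1−i)`; two fields at one
level): `dist1_corr_mul_inv_scaled_le` (`…·ℓ² ≤ κ₀ < δ_N`, `…·ℓ³ ≤ κ₁ ⟹ dist1 (corr U′ c′ * (corr U c)⁻¹)·ℓ³ ≤ 9∕4·κ₁`), its matrix form, and the
threshold-free `dist1_corr_mul_inv_scaled_le_add` (`≤ 9∕4·κ₁ + 3κ₀²∕δ_N`).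
Inputs BY NAME: `MatrixLog.analyticAt_mlog ∕ norm_mlog_le_neg_log`, `LogFDeriv.hasFDerivAt_logOnePlus_sub_one ∕ norm_tsum_term_le`,
`ExpFDeriv.differentiableAt_exp ∕ fderiv_exp ∕ norm_fderiv_exp_le`, `Convex.norm_image_sub_le_of_norm_fderiv_le`, `B7TransferAnalyticMean.norm_meanCLM_apply_le`,
`BlockAveragingEMLAnalyticMean.eml_eq_exp_meanCLM ∕ coe_expMeanLogSU_E_eq_eml`, `ExpMeanLog.lt_third_of_lt_deltaSU ∕ deltaSU_pos`, κ-L4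
`B13AvgCorrEml.small_of_le ∕ dist1_corr_le_three_halves_mul`, `CStarRing.norm_mul_mem_unitary`, `Unitary.star_mul_self_of_mem`.
0 sorry; axioms ⊆ {propext, Classical.choice, Quot.sound}.
-/

noncomputable section

open scoped BigOperators Matrix.Norms.L2Operator

namespace Summit.QuantumFields.BalabanUV.T4Continuum.B13AvgCorrEmlVariation

open NormedSpace
open Literature.MathematicalPhysics.QuantumFieldTheory.Balaban1983to89
open Literature.MathematicalPhysics.QuantumFieldTheory.Balaban1983to89.MatrixLog (mlog analyticAt_mlog norm_mlog_le_neg_log)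
open Literature.MathematicalPhysics.QuantumFieldTheory.Balaban1983to89.B7TransferAnalyticMean (meanCLM norm_meanCLM_apply_le)
open Literature.MathematicalPhysics.QuantumFieldTheory.Balaban1983to89.ExpMeanLog
  (eml deltaSU deltaSU_pos expMeanLogSU lt_third_of_lt_deltaSU)
open Literature.MathematicalPhysics.QuantumFieldTheory.Balaban1983to89.BlockAveragingEMLAnalyticMean
  (eml_eq_exp_meanCLM coe_expMeanLogSU_E_eq_eml)
open Literature.Analysis.SpecialFunctions

/-! ## §1 Lipschitz bounds for `log`, `exp` and `exp[mean log]` on closed polydiscs -/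

section Generic

variable {𝔸 : Type*} [NormedRing 𝔸] [NormedAlgebra ℂ 𝔸] [CompleteSpace 𝔸]

/-- [folklore] **`log` IS `(1−ρ)⁻¹`-LIPSCHITZ ON THE CLOSED BALL `‖X − 1‖ ≤ ρ < 1`**: the mean-value inequality on the (convex) closed ball with the
derivative bound `‖D log(1+x)‖ ≤ (1 − ‖x‖)⁻¹ ≤ (1 − ρ)⁻¹` of `LogFDeriv`. -/
theorem norm_mlog_sub_mlog_le {ρ : ℝ} (hρ1 : ρ < 1) {X Y : 𝔸} (hX : ‖X - 1‖ ≤ ρ) (hY : ‖Y - 1‖ ≤ ρ) :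
    ‖mlog Y - mlog X‖ ≤ (1 - ρ)⁻¹ * ‖Y - X‖ := by
  have hmem : ∀ {Z : 𝔸}, ‖Z - 1‖ ≤ ρ → Z ∈ Metric.closedBall (1 : 𝔸) ρ := fun h => by rwa [Metric.mem_closedBall, dist_eq_norm]
  have hle : ∀ {Z : 𝔸}, Z ∈ Metric.closedBall (1 : 𝔸) ρ → ‖Z - 1‖ ≤ ρ := fun h => by rwa [Metric.mem_closedBall, dist_eq_norm] at h
  have hdiff : ∀ Z ∈ Metric.closedBall (1 : 𝔸) ρ, DifferentiableAt ℂ (mlog : 𝔸 → 𝔸) Z := fun Z hZ =>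
    (analyticAt_mlog ((hle hZ).trans_lt hρ1)).differentiableAt
  have hbound : ∀ Z ∈ Metric.closedBall (1 : 𝔸) ρ, ‖fderiv ℂ (mlog : 𝔸 → 𝔸) Z‖ ≤ (1 - ρ)⁻¹ := fun Z hZ => by
    have hZ1 : ‖Z - 1‖ < 1 := (hle hZ).trans_lt hρ1
    have e : (mlog : 𝔸 → 𝔸) = fun W : 𝔸 => Literature.Analysis.Complex.logOnePlus (W - 1) := rfl
    rw [e, (LogFDeriv.hasFDerivAt_logOnePlus_sub_one hZ1).fderiv]
    refine (LogFDeriv.norm_tsum_term_le hZ1).trans ?_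
    exact inv_anti₀ (by linarith) (by linarith [hle hZ])
  exact (convex_closedBall (1 : 𝔸) ρ).norm_image_sub_le_of_norm_fderiv_le hdiff hbound (hmem hX) (hmem hY)

variable {ι : Type*} [Fintype ι]

/-- [folklore] the mean of the logarithms of a family in the closed polydisc `‖U i − 1‖ ≤ ρ` (`0 ≤ ρ < 1`) has norm `≤ −log(1 − ρ)` (κ-L4's first
step, isolated; (26) termwise and `‖mean‖ ≤ sup`). -/
theorem norm_meanCLM_mlog_le {ρ : ℝ} (hρ0 : 0 ≤ ρ) (hρ1 : ρ < 1) {U : ι → 𝔸} (hU : ∀ i, ‖U i - 1‖ ≤ ρ) :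
    ‖meanCLM ι 𝔸 (fun j => mlog (U j))‖ ≤ -Real.log (1 - ρ) := by
  have hlog0 : 0 ≤ -Real.log (1 - ρ) := by linarith [Real.log_nonpos (show (0 : ℝ) ≤ 1 - ρ by linarith) (show 1 - ρ ≤ 1 by linarith)]
  refine (norm_meanCLM_apply_le _).trans ((pi_norm_le_iff_of_nonneg hlog0).2 fun j => ?_)
  refine (norm_mlog_le_neg_log ((hU j).trans_lt hρ1)).trans (neg_le_neg (Real.log_le_log (by linarith) ?_))
  linarith [hU j]

/-- [folklore] the means of the logarithms of two families in the closed polydisc of radius `ρ < 1` differ by at most `(1−ρ)⁻¹·‖U′ − U‖`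
(linearity of the mean, `‖mean‖ ≤ sup`, `norm_mlog_sub_mlog_le` componentwise). -/
theorem norm_meanCLM_mlog_sub_le {ρ : ℝ} (hρ1 : ρ < 1) {U U' : ι → 𝔸} (hU : ∀ i, ‖U i - 1‖ ≤ ρ) (hU' : ∀ i, ‖U' i - 1‖ ≤ ρ) :
    ‖meanCLM ι 𝔸 (fun j => mlog (U' j)) - meanCLM ι 𝔸 (fun j => mlog (U j))‖ ≤ (1 - ρ)⁻¹ * ‖U' - U‖ := by
  have h1ρ : 0 < 1 - ρ := by linarith
  rw [← map_sub]; refine (norm_meanCLM_apply_le _).trans ((pi_norm_le_iff_of_nonneg (by positivity)).2 fun j => ?_)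
  show ‖mlog (U' j) - mlog (U j)‖ ≤ (1 - ρ)⁻¹ * ‖U' - U‖
  calc ‖mlog (U' j) - mlog (U j)‖ ≤ (1 - ρ)⁻¹ * ‖U' j - U j‖ := norm_mlog_sub_mlog_le hρ1 (hU j) (hU' j)
    _ ≤ (1 - ρ)⁻¹ * ‖U' - U‖ := by gcongr; exact norm_le_pi_norm (U' - U) j

variable [NormOneClass 𝔸]

omit [Fintype ι] in
/-- [folklore] **`exp` IS `e^r`-LIPSCHITZ ON THE CLOSED BALL `‖Z‖ ≤ r`**: the mean-value inequality with `‖D exp(Z)‖ ≤ e^{‖Z‖} ≤ e^r` (`ExpFDeriv`). -/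
theorem norm_exp_sub_exp_le_of_norm_le {r : ℝ} {Z Z' : 𝔸} (hZ : ‖Z‖ ≤ r) (hZ' : ‖Z'‖ ≤ r) :
    ‖exp Z' - exp Z‖ ≤ Real.exp r * ‖Z' - Z‖ := by
  have hmem : ∀ {W : 𝔸}, ‖W‖ ≤ r → W ∈ Metric.closedBall (0 : 𝔸) r := fun h => by rwa [mem_closedBall_zero_iff]
  have hdiff : ∀ W ∈ Metric.closedBall (0 : 𝔸) r, DifferentiableAt ℂ (exp : 𝔸 → 𝔸) W := fun W _ =>
    ExpFDeriv.differentiableAt_exp ℂ W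
  have hbound : ∀ W ∈ Metric.closedBall (0 : 𝔸) r, ‖fderiv ℂ (exp : 𝔸 → 𝔸) W‖ ≤ Real.exp r := fun W hW => by
    rw [ExpFDeriv.fderiv_exp ℂ W]
    exact (ExpFDeriv.norm_fderiv_exp_le ℂ W).trans (Real.exp_le_exp.2 (mem_closedBall_zero_iff.1 hW))
  exact (convex_closedBall (0 : 𝔸) r).norm_image_sub_le_of_norm_fderiv_le hdiff hbound (hmem hZ) (hmem hZ')

/-- [folklore] **THE ONE-DIFFERENCE TWIN OF «THE AVERAGE IS CLOSE TO THE IDENTITY»**: two families in the closed polydisc `‖U i − 1‖, ‖U′ i − 1‖ ≤ ρ`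
(`0 ≤ ρ < 1`) have `‖eml U′ − eml U‖ ≤ ‖U′ − U‖∕(1 − ρ)²` — one factor `(1−ρ)⁻¹` is the Lipschitz constant of `log` on the polydisc, the other is
`e^{−log(1−ρ)}`, the Lipschitz constant of `exp` on the ball `‖Z‖ ≤ −log(1−ρ)` that contains both means of logarithms. -/
theorem norm_eml_sub_eml_le {ρ : ℝ} (hρ0 : 0 ≤ ρ) (hρ1 : ρ < 1) {U U' : ι → 𝔸}
    (hU : ∀ i, ‖U i - 1‖ ≤ ρ) (hU' : ∀ i, ‖U' i - 1‖ ≤ ρ) :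
    ‖eml U' - eml U‖ ≤ ‖U' - U‖ / (1 - ρ) ^ 2 := by
  have h1ρ : 0 < 1 - ρ := by linarith
  rw [eml_eq_exp_meanCLM, eml_eq_exp_meanCLM]
  calc ‖exp (meanCLM ι 𝔸 fun j => mlog (U' j)) - exp (meanCLM ι 𝔸 fun j => mlog (U j))‖
      ≤ Real.exp (-Real.log (1 - ρ)) * ‖meanCLM ι 𝔸 (fun j => mlog (U' j)) - meanCLM ι 𝔸 (fun j => mlog (U j))‖ :=
        norm_exp_sub_exp_le_of_norm_le (norm_meanCLM_mlog_le hρ0 hρ1 hU) (norm_meanCLM_mlog_le hρ0 hρ1 hU')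
    _ = (1 - ρ)⁻¹ * ‖meanCLM ι 𝔸 (fun j => mlog (U' j)) - meanCLM ι 𝔸 (fun j => mlog (U j))‖ := by rw [Real.exp_neg, Real.exp_log h1ρ]
    _ ≤ (1 - ρ)⁻¹ * ((1 - ρ)⁻¹ * ‖U' - U‖) := by gcongr; exact norm_meanCLM_mlog_sub_le hρ1 hU hU'
    _ = ‖U' - U‖ / (1 - ρ) ^ 2 := by field_simp

/-- [folklore] componentwise form: `∀ i, ‖U′ i − U i‖ ≤ δ` (nonempty index type) ⟹ `‖eml U′ − eml U‖ ≤ δ∕(1 − ρ)²`. -/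
theorem norm_eml_sub_eml_le_of_forall [Nonempty ι] {ρ δ : ℝ} (hρ0 : 0 ≤ ρ) (hρ1 : ρ < 1) {U U' : ι → 𝔸}
    (hU : ∀ i, ‖U i - 1‖ ≤ ρ) (hU' : ∀ i, ‖U' i - 1‖ ≤ ρ) (hd : ∀ i, ‖U' i - U i‖ ≤ δ) :
    ‖eml U' - eml U‖ ≤ δ / (1 - ρ) ^ 2 := by
  have hδ : 0 ≤ δ := (norm_nonneg _).trans (hd (Classical.arbitrary ι))
  have hn : ‖U' - U‖ ≤ δ := (pi_norm_le_iff_of_nonneg hδ).2 fun i => hd i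
  calc ‖eml U' - eml U‖ ≤ ‖U' - U‖ / (1 - ρ) ^ 2 := norm_eml_sub_eml_le hρ0 hρ1 hU hU'
    _ ≤ δ / (1 - ρ) ^ 2 := by gcongr

end Generic

/-- [folklore] arithmetic: `δ∕(1 − ρ)² ≤ (9∕4)·δ` for `0 ≤ δ`, `ρ ≤ 1∕3`. -/
theorem div_sq_le_nine_fourths_mul {ρ δ : ℝ} (hδ : 0 ≤ δ) (hρ : ρ ≤ 1 / 3) : δ / (1 - ρ) ^ 2 ≤ 9 / 4 * δ := by
  have h49 : (4 : ℝ) / 9 ≤ (1 - ρ) ^ 2 := by nlinarith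
  rw [div_le_iff₀ (lt_of_lt_of_le (by norm_num) h49)]
  nlinarith

/-! ## §2 The quotient currency `dist1 (a * b⁻¹)` is the matrix-difference currency; two families under the printed `SU(N)` average -/

section Realisation

variable {G : Type*} [GaugeGroup G] {o : Type*} [Fintype o] [DecidableEq o]

/-- [folklore] **THE CURRENCY BRIDGE** for any gauge group realised by a unitary `ι : G →* M_o(ℂ)` with `‖ι g − 1‖ = dist1 g` (the substrate's
`hι`∕`hdist` letters): `‖ι a − ι b‖ = dist1 (a * b⁻¹)` — right multiplication by the unitary `ι b` is an isometry of the operator norm. -/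
theorem norm_map_sub_map_eq_dist1 (ι : G →* Matrix o o ℂ) (hι : ∀ g, ι g ∈ Matrix.unitaryGroup o ℂ)
    (hdist : ∀ g, ‖ι g - 1‖ = dist1 g) (a b : G) : ‖ι a - ι b‖ = dist1 (a * b⁻¹) := by
  rw [← hdist]
  have e : ι a - ι b = (ι (a * b⁻¹) - 1) * ι b := by
    rw [sub_mul, one_mul, ← map_mul, inv_mul_cancel_right]
  rw [e, CStarRing.norm_mul_mem_unitary _ (hι b)]

end Realisation

section SUN

variable {n : Type*} [Fintype n] [DecidableEq n] [Nonempty n]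

omit [Nonempty n] in
/-- [folklore] the matrix of an element of `SU(N)` is unitary. -/
theorem coe_mem_unitaryGroup (g : Matrix.specialUnitaryGroup n ℂ) : (g : Matrix n n ℂ) ∈ Matrix.unitaryGroup n ℂ :=
  (Matrix.mem_specialUnitaryGroup_iff.1 g.2).1

/-- [folklore] **`dist1 (g * h⁻¹) = ‖g − h‖_{op}` ON `SU(N)`** (`dist1 = ‖· − 1‖_{op}` by `rfl`; `(g h⁻¹ − 1)·h = g − h` and right multiplication
by the unitary `h` is an isometry): σ-L1's quotient currency IS the matrix-difference currency of the memo's (C1). -/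
theorem dist1_mul_inv_eq_norm_sub (g h : Matrix.specialUnitaryGroup n ℂ) :
    dist1 (g * h⁻¹) = ‖(g : Matrix n n ℂ) - (h : Matrix n n ℂ)‖ := by
  have hu : (h : Matrix n n ℂ) ∈ Matrix.unitaryGroup n ℂ := coe_mem_unitaryGroup h
  have hsh : star (h : Matrix n n ℂ) * (h : Matrix n n ℂ) = 1 := Unitary.star_mul_self_of_mem hu
  show ‖(g : Matrix n n ℂ) * star (h : Matrix n n ℂ) - 1‖ = ‖(g : Matrix n n ℂ) - (h : Matrix n n ℂ)‖
  have e : (g : Matrix n n ℂ) - (h : Matrix n n ℂ) = ((g : Matrix n n ℂ) * star (h : Matrix n n ℂ) - 1) * (h : Matrix n n ℂ) := by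
    rw [sub_mul, one_mul, mul_assoc, hsh, mul_one]
  rw [e, CStarRing.norm_mul_mem_unitary _ hu]

/-- [folklore] **TWO FAMILIES UNDER `expMeanLogSU.E`, ON THE GUARD**: `∀ i, dist1 (W i), dist1 (W′ i) ≤ ρ < 1` and `dist1 (W′ i * (W i)⁻¹) ≤ δ` give
`dist1 (E W′ * (E W)⁻¹) ≤ δ∕(1 − ρ)²` (`E = eml` of the matrices on the guard; §1 on `M_N(ℂ)` with the `L²`-operator norm). -/
theorem dist1_E_mul_inv_le_div {m : ℕ} (W W' : Fin (m + 1) → Matrix.specialUnitaryGroup n ℂ)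
    (hW : ∀ i, dist1 (W i) < deltaSU n) (hW' : ∀ i, dist1 (W' i) < deltaSU n)
    {ρ : ℝ} (hρ1 : ρ < 1) (hWρ : ∀ i, dist1 (W i) ≤ ρ) (hW'ρ : ∀ i, dist1 (W' i) ≤ ρ)
    {δ : ℝ} (hd : ∀ i, dist1 (W' i * (W i)⁻¹) ≤ δ) :
    dist1 ((expMeanLogSU (n := n)).E W' * ((expMeanLogSU (n := n)).E W)⁻¹) ≤ δ / (1 - ρ) ^ 2 := by
  have hρ0 : 0 ≤ ρ := (GaugeGroup.dist1_nonneg _).trans (hWρ 0)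
  rw [dist1_mul_inv_eq_norm_sub, coe_expMeanLogSU_E_eq_eml W' hW', coe_expMeanLogSU_E_eq_eml W hW]
  refine norm_eml_sub_eml_le_of_forall hρ0 hρ1 (fun i => hWρ i) (fun i => hW'ρ i) fun i => ?_
  rw [← dist1_mul_inv_eq_norm_sub]; exact hd i

/-- [folklore] **… LINEAR, at the guard's radius**: `ρ < δ_N (≤ 1∕3)` ⟹ `dist1 (E W′ * (E W)⁻¹) ≤ (9∕4)·δ`. -/
theorem dist1_E_mul_inv_le {m : ℕ} (W W' : Fin (m + 1) → Matrix.specialUnitaryGroup n ℂ)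
    {ρ : ℝ} (hρ : ρ < deltaSU n) (hWρ : ∀ i, dist1 (W i) ≤ ρ) (hW'ρ : ∀ i, dist1 (W' i) ≤ ρ)
    {δ : ℝ} (hd : ∀ i, dist1 (W' i * (W i)⁻¹) ≤ δ) :
    dist1 ((expMeanLogSU (n := n)).E W' * ((expMeanLogSU (n := n)).E W)⁻¹) ≤ 9 / 4 * δ := by
  have hρ3 : ρ < 1 / 3 := lt_third_of_lt_deltaSU hρ
  have hδ : 0 ≤ δ := (GaugeGroup.dist1_nonneg _).trans (hd 0)
  exact (dist1_E_mul_inv_le_div W W' (fun i => (hWρ i).trans_lt hρ) (fun i => (hW'ρ i).trans_lt hρ) (by linarith) hWρ hW'ρ hd).trans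
    (div_sq_le_nine_fourths_mul hδ hρ3.le)

variable {ι : Type*} [Fintype ι] [Nonempty ι]

/-- [folklore] two families over an arbitrary nonempty finite index type (`LoopAverage.avg` = `E` after the fixed enumeration), on the guard:
`dist1 (avg W′ * (avg W)⁻¹) ≤ δ∕(1 − ρ)²`. -/
theorem dist1_avg_mul_inv_le_div (W W' : ι → Matrix.specialUnitaryGroup n ℂ)
    (hW : ∀ i, dist1 (W i) < deltaSU n) (hW' : ∀ i, dist1 (W' i) < deltaSU n)
    {ρ : ℝ} (hρ1 : ρ < 1) (hWρ : ∀ i, dist1 (W i) ≤ ρ) (hW'ρ : ∀ i, dist1 (W' i) ≤ ρ)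
    {δ : ℝ} (hd : ∀ i, dist1 (W' i * (W i)⁻¹) ≤ δ) :
    dist1 ((expMeanLogSU (n := n)).avg W' * ((expMeanLogSU (n := n)).avg W)⁻¹) ≤ δ / (1 - ρ) ^ 2 := by
  unfold LoopAverage.avg
  exact dist1_E_mul_inv_le_div _ _ (fun i => hW _) (fun i => hW' _) hρ1 (fun i => hWρ _) (fun i => hW'ρ _) fun i => hd _

/-- [folklore] … linear at the guard's radius: `dist1 (avg W′ * (avg W)⁻¹) ≤ (9∕4)·δ`. -/
theorem dist1_avg_mul_inv_le (W W' : ι → Matrix.specialUnitaryGroup n ℂ)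
    {ρ : ℝ} (hρ : ρ < deltaSU n) (hWρ : ∀ i, dist1 (W i) ≤ ρ) (hW'ρ : ∀ i, dist1 (W' i) ≤ ρ)
    {δ : ℝ} (hd : ∀ i, dist1 (W' i * (W i)⁻¹) ≤ δ) :
    dist1 ((expMeanLogSU (n := n)).avg W' * ((expMeanLogSU (n := n)).avg W)⁻¹) ≤ 9 / 4 * δ := by
  unfold LoopAverage.avg
  exact dist1_E_mul_inv_le _ _ hρ (fun i => hWρ _) (fun i => hW'ρ _) fun i => hd _

end SUN

/-! ## §3 At the block-averaging step: the variation of the correction factor from the variation of the loop variables -/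

section Block

open Literature.MathematicalPhysics.QuantumFieldTheory.Balaban1983to89.BlockAveraging (Idx loopHol Small corr)
open Summit.QuantumFields.BalabanUV.T4Continuum.B13AvgCorrEml (small_of_le dist1_corr_le_three_halves_mul)

variable {P : Params} {j j' : ℕ} {n : Type*} [Fintype n] [DecidableEq n] [Nonempty n]

/-- [folklore] **BOTH ON THE GUARD**: for two (field, bond) pairs with `Small` families of loop variables, all within `ρ < 1` of `1` and pairwise
`δ`-close in the quotient currency, `dist1 (corr U′ c′ * (corr U c)⁻¹) ≤ δ∕(1 − ρ)²` (`corr = avg (loopHol …)` on the guard). -/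
theorem dist1_corr_mul_inv_le_of_small (U : GaugeField P j (Matrix.specialUnitaryGroup n ℂ)) (c : PBond P (j + 1))
    (U' : GaugeField P j' (Matrix.specialUnitaryGroup n ℂ)) (c' : PBond P (j' + 1))
    (hS : Small (expMeanLogSU (n := n)) U c) (hS' : Small (expMeanLogSU (n := n)) U' c')
    {ρ : ℝ} (hρ1 : ρ < 1) (h : ∀ i, dist1 (loopHol U c i) ≤ ρ) (h' : ∀ i, dist1 (loopHol U' c' i) ≤ ρ)
    {δ : ℝ} (hd : ∀ i, dist1 (loopHol U' c' i * (loopHol U c i)⁻¹) ≤ δ) :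
    dist1 (corr (expMeanLogSU (n := n)) U' c' * (corr (expMeanLogSU (n := n)) U c)⁻¹) ≤ δ / (1 - ρ) ^ 2 := by
  unfold corr; rw [if_pos hS, if_pos hS']
  exact dist1_avg_mul_inv_le_div _ _ hS hS' hρ1 h h' hd

/-- [folklore] **THE END OF THE BRICK**: if every (0.4) loop variable of `(U, c)` and of `(U′, c′)` is within `ρ < δ_N` of `1` and the two families
are `δ`-close, `dist1 (loopHol U′ c′ i * (loopHol U c i)⁻¹) ≤ δ`, then the correction factors of the printed average are `(9∕4)·δ`-close:
`dist1 (corr expMeanLogSU U′ c′ * (corr expMeanLogSU U c)⁻¹) ≤ 9∕4 * δ`.  σ-END feeds `ρ := κ₀∕ℓ²` (κ-chain) and `δ := κ₁∕ℓ³` (σ-L1 × σ-L2). -/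
theorem dist1_corr_mul_inv_le (U : GaugeField P j (Matrix.specialUnitaryGroup n ℂ)) (c : PBond P (j + 1))
    (U' : GaugeField P j' (Matrix.specialUnitaryGroup n ℂ)) (c' : PBond P (j' + 1))
    {ρ : ℝ} (hρ : ρ < deltaSU n) (h : ∀ i, dist1 (loopHol U c i) ≤ ρ) (h' : ∀ i, dist1 (loopHol U' c' i) ≤ ρ)
    {δ : ℝ} (hd : ∀ i, dist1 (loopHol U' c' i * (loopHol U c i)⁻¹) ≤ δ) :
    dist1 (corr (expMeanLogSU (n := n)) U' c' * (corr (expMeanLogSU (n := n)) U c)⁻¹) ≤ 9 / 4 * δ := by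
  have hρ0 : 0 ≤ ρ := (GaugeGroup.dist1_nonneg _).trans (h (Classical.arbitrary (Idx P)))
  have hδ : 0 ≤ δ := (GaugeGroup.dist1_nonneg _).trans (hd (Classical.arbitrary (Idx P)))
  have hρ3 : ρ < 1 / 3 := lt_third_of_lt_deltaSU hρ
  exact (dist1_corr_mul_inv_le_of_small U c U' c' (small_of_le U c h hρ) (small_of_le U' c' h' hρ) (by linarith) h h' hd).trans
    (div_sq_le_nine_fourths_mul hδ hρ3.le)

/-- [folklore] the `δ∕(1 − ρ)²` form of the END under `ρ < δ_N` (sharper than `9∕4` when `ρ` is small). -/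
theorem dist1_corr_mul_inv_le_div (U : GaugeField P j (Matrix.specialUnitaryGroup n ℂ)) (c : PBond P (j + 1))
    (U' : GaugeField P j' (Matrix.specialUnitaryGroup n ℂ)) (c' : PBond P (j' + 1))
    {ρ : ℝ} (hρ : ρ < deltaSU n) (h : ∀ i, dist1 (loopHol U c i) ≤ ρ) (h' : ∀ i, dist1 (loopHol U' c' i) ≤ ρ)
    {δ : ℝ} (hd : ∀ i, dist1 (loopHol U' c' i * (loopHol U c i)⁻¹) ≤ δ) :
    dist1 (corr (expMeanLogSU (n := n)) U' c' * (corr (expMeanLogSU (n := n)) U c)⁻¹) ≤ δ / (1 - ρ) ^ 2 :=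
  dist1_corr_mul_inv_le_of_small U c U' c' (small_of_le U c h hρ) (small_of_le U' c' h' hρ)
    ((lt_third_of_lt_deltaSU hρ).trans (by norm_num)) h h' hd

/-- [folklore] the END in the MATRIX-DIFFERENCE currency of the memo's (C1): `‖(corr U′ c′ : M_N) − (corr U c : M_N)‖_{op} ≤ 9∕4 * δ`. -/
theorem norm_coe_corr_sub_coe_corr_le (U : GaugeField P j (Matrix.specialUnitaryGroup n ℂ)) (c : PBond P (j + 1))
    (U' : GaugeField P j' (Matrix.specialUnitaryGroup n ℂ)) (c' : PBond P (j' + 1))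
    {ρ : ℝ} (hρ : ρ < deltaSU n) (h : ∀ i, dist1 (loopHol U c i) ≤ ρ) (h' : ∀ i, dist1 (loopHol U' c' i) ≤ ρ)
    {δ : ℝ} (hd : ∀ i, dist1 (loopHol U' c' i * (loopHol U c i)⁻¹) ≤ δ) :
    ‖((corr (expMeanLogSU (n := n)) U' c' : Matrix.specialUnitaryGroup n ℂ) : Matrix n n ℂ)
        - ((corr (expMeanLogSU (n := n)) U c : Matrix.specialUnitaryGroup n ℂ) : Matrix n n ℂ)‖ ≤ 9 / 4 * δ := by
  rw [← dist1_mul_inv_eq_norm_sub]; exact dist1_corr_mul_inv_le U c U' c' hρ h h' hd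

/-- [folklore] **THE THRESHOLD-FREE COMPANION**: for EVERY `ρ`, `dist1 (corr U′ c′ * (corr U c)⁻¹) ≤ 9∕4 * δ + 3 * ρ² ∕ δ_N`.  If `ρ < δ_N` this is
the END; otherwise both correction factors are within `(3∕2)ρ` of `1` (κ-L4, no threshold) and `3ρ ≤ 3ρ²∕δ_N`.  (A bound linear in `δ` alone is
impossible without the guard hypothesis: the total extension `corr` jumps from `E(W)` to `1` across `dist1 = δ_N`.) -/
theorem dist1_corr_mul_inv_le_add (U : GaugeField P j (Matrix.specialUnitaryGroup n ℂ)) (c : PBond P (j + 1))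
    (U' : GaugeField P j' (Matrix.specialUnitaryGroup n ℂ)) (c' : PBond P (j' + 1))
    {ρ : ℝ} (h : ∀ i, dist1 (loopHol U c i) ≤ ρ) (h' : ∀ i, dist1 (loopHol U' c' i) ≤ ρ)
    {δ : ℝ} (hd : ∀ i, dist1 (loopHol U' c' i * (loopHol U c i)⁻¹) ≤ δ) :
    dist1 (corr (expMeanLogSU (n := n)) U' c' * (corr (expMeanLogSU (n := n)) U c)⁻¹) ≤ 9 / 4 * δ + 3 * ρ ^ 2 / deltaSU n := by
  have hN : 0 < deltaSU n := deltaSU_pos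
  have hρ0 : 0 ≤ ρ := (GaugeGroup.dist1_nonneg _).trans (h (Classical.arbitrary (Idx P)))
  have hδ : 0 ≤ δ := (GaugeGroup.dist1_nonneg _).trans (hd (Classical.arbitrary (Idx P)))
  by_cases hρ : ρ < deltaSU n
  · exact (dist1_corr_mul_inv_le U c U' c' hρ h h' hd).trans (le_add_of_nonneg_right (by positivity))
  · rw [not_lt] at hρ
    calc dist1 (corr (expMeanLogSU (n := n)) U' c' * (corr (expMeanLogSU (n := n)) U c)⁻¹)
        ≤ dist1 (corr (expMeanLogSU (n := n)) U' c') + dist1 (corr (expMeanLogSU (n := n)) U c)⁻¹ := GaugeGroup.dist1_mul_le _ _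
      _ = dist1 (corr (expMeanLogSU (n := n)) U' c') + dist1 (corr (expMeanLogSU (n := n)) U c) := by rw [GaugeGroup.dist1_inv]
      _ ≤ 3 / 2 * ρ + 3 / 2 * ρ := add_le_add (dist1_corr_le_three_halves_mul U' c' h') (dist1_corr_le_three_halves_mul U c h)
      _ = 3 * ρ := by ring
      _ ≤ 3 * ρ ^ 2 / deltaSU n := by rw [le_div_iff₀ hN]; nlinarith
      _ ≤ 9 / 4 * δ + 3 * ρ ^ 2 / deltaSU n := le_add_of_nonneg_left (by positivity)

end Block

/-! ## §4 In SCALED currency (`ℓ ≥ 1` the coarse scale; for σ-END ∕ the substrate's second-order window) -/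

section Scaled

open Literature.MathematicalPhysics.QuantumFieldTheory.Balaban1983to89.BlockAveraging (Idx loopHol corr)

variable {P : Params} {j : ℕ} {n : Type*} [Fintype n] [DecidableEq n] [Nonempty n]

/-- [folklore] **THE END IN SCALED CURRENCY**: at one level, for two fields `U`, `U′` and two coarse bonds `c`, `c′`, from the κ-letters
`dist1 (loopHol U c i)·ℓ² ≤ κ₀`, `dist1 (loopHol U′ c′ i)·ℓ² ≤ κ₀` with `κ₀ < δ_N` and the σ-letter `dist1 (loopHol U′ c′ i * (loopHol U c i)⁻¹)·ℓ³ ≤ κ₁`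
(`1 ≤ ℓ`) conclude `dist1 (corr U′ c′ * (corr U c)⁻¹)·ℓ³ ≤ (9∕4)·κ₁`. -/
theorem dist1_corr_mul_inv_scaled_le (U U' : GaugeField P j (Matrix.specialUnitaryGroup n ℂ)) (c c' : PBond P (j + 1))
    {κ₀ κ₁ ℓ : ℝ} (hℓ : 1 ≤ ℓ) (hκ₀ : κ₀ < deltaSU n)
    (h : ∀ i, dist1 (loopHol U c i) * ℓ ^ 2 ≤ κ₀) (h' : ∀ i, dist1 (loopHol U' c' i) * ℓ ^ 2 ≤ κ₀)
    (hd : ∀ i, dist1 (loopHol U' c' i * (loopHol U c i)⁻¹) * ℓ ^ 3 ≤ κ₁) :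
    dist1 (corr (expMeanLogSU (n := n)) U' c' * (corr (expMeanLogSU (n := n)) U c)⁻¹) * ℓ ^ 3 ≤ 9 / 4 * κ₁ := by
  have hℓ0 : (0 : ℝ) < ℓ := by linarith
  have hℓ2 : (0 : ℝ) < ℓ ^ 2 := by positivity
  have hℓ3 : (0 : ℝ) < ℓ ^ 3 := by positivity
  have hκ₀0 : 0 ≤ κ₀ := le_trans (mul_nonneg (GaugeGroup.dist1_nonneg _) hℓ2.le) (h (Classical.arbitrary (Idx P)))
  have hρ : κ₀ / ℓ ^ 2 < deltaSU n := lt_of_le_of_lt (div_le_self hκ₀0 (by nlinarith)) hκ₀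
  have hh : ∀ i, dist1 (loopHol U c i) ≤ κ₀ / ℓ ^ 2 := fun i => (le_div_iff₀ hℓ2).2 (h i)
  have hh' : ∀ i, dist1 (loopHol U' c' i) ≤ κ₀ / ℓ ^ 2 := fun i => (le_div_iff₀ hℓ2).2 (h' i)
  have hdd : ∀ i, dist1 (loopHol U' c' i * (loopHol U c i)⁻¹) ≤ κ₁ / ℓ ^ 3 := fun i => (le_div_iff₀ hℓ3).2 (hd i)
  have H := dist1_corr_mul_inv_le U c U' c' hρ hh hh' hdd
  rw [← le_div_iff₀ hℓ3, mul_div_assoc]; exact H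

/-- [folklore] **THE THRESHOLD-FREE END IN SCALED CURRENCY**: without `κ₀ < δ_N`, `dist1 (corr U′ c′ * (corr U c)⁻¹)·ℓ³ ≤ (9∕4)·κ₁ + 3κ₀²∕δ_N`
(the guard-jump term `3(κ₀∕ℓ²)²∕δ_N·ℓ³ = 3κ₀²∕(δ_N·ℓ) ≤ 3κ₀²∕δ_N` for `ℓ ≥ 1`). -/
theorem dist1_corr_mul_inv_scaled_le_add (U U' : GaugeField P j (Matrix.specialUnitaryGroup n ℂ)) (c c' : PBond P (j + 1))
    {κ₀ κ₁ ℓ : ℝ} (hℓ : 1 ≤ ℓ)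
    (h : ∀ i, dist1 (loopHol U c i) * ℓ ^ 2 ≤ κ₀) (h' : ∀ i, dist1 (loopHol U' c' i) * ℓ ^ 2 ≤ κ₀)
    (hd : ∀ i, dist1 (loopHol U' c' i * (loopHol U c i)⁻¹) * ℓ ^ 3 ≤ κ₁) :
    dist1 (corr (expMeanLogSU (n := n)) U' c' * (corr (expMeanLogSU (n := n)) U c)⁻¹) * ℓ ^ 3
      ≤ 9 / 4 * κ₁ + 3 * κ₀ ^ 2 / deltaSU n := by
  have hN : 0 < deltaSU n := deltaSU_pos
  have hℓ0 : (0 : ℝ) < ℓ := by linarith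
  have hℓ2 : (0 : ℝ) < ℓ ^ 2 := by positivity
  have hℓ3 : (0 : ℝ) < ℓ ^ 3 := by positivity
  have hh : ∀ i, dist1 (loopHol U c i) ≤ κ₀ / ℓ ^ 2 := fun i => (le_div_iff₀ hℓ2).2 (h i)
  have hh' : ∀ i, dist1 (loopHol U' c' i) ≤ κ₀ / ℓ ^ 2 := fun i => (le_div_iff₀ hℓ2).2 (h' i)
  have hdd : ∀ i, dist1 (loopHol U' c' i * (loopHol U c i)⁻¹) ≤ κ₁ / ℓ ^ 3 := fun i => (le_div_iff₀ hℓ3).2 (hd i)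
  have H := dist1_corr_mul_inv_le_add U c U' c' hh hh' hdd
  have hκ₁ : 0 ≤ κ₁ := le_trans (mul_nonneg (GaugeGroup.dist1_nonneg _) hℓ3.le) (hd (Classical.arbitrary (Idx P)))
  calc dist1 (corr (expMeanLogSU (n := n)) U' c' * (corr (expMeanLogSU (n := n)) U c)⁻¹) * ℓ ^ 3
      ≤ (9 / 4 * (κ₁ / ℓ ^ 3) + 3 * (κ₀ / ℓ ^ 2) ^ 2 / deltaSU n) * ℓ ^ 3 := by gcongr
    _ = 9 / 4 * κ₁ + 3 * κ₀ ^ 2 / deltaSU n * (1 / ℓ) := by field_simp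
    _ ≤ 9 / 4 * κ₁ + 3 * κ₀ ^ 2 / deltaSU n * 1 := by gcongr; exact (div_le_one hℓ0).2 hℓ
    _ = 9 / 4 * κ₁ + 3 * κ₀ ^ 2 / deltaSU n := by ring

end Scaled

/-! ## §5 In the display shape of the tower letter (one line for σ-END; cf. κ-L4 §4 `hκ_of_loopHol_le`) -/

section Tower

open Literature.MathematicalPhysics.QuantumFieldTheory.Balaban1983to89.BlockAveraging (Idx loopHol corr)
open Summit.QuantumFields.BalabanUV.T4Continuum.SubstrateAvgTowerStructure (avgTower)

variable {P : Params} {n : Type*} [Fintype n] [DecidableEq n] [Nonempty n]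

/-- [folklore] **σ-L4 ALONG TWO AVERAGING TOWERS** `U_i = avgTower ℰ V i`, `U′_i = avgTower ℰ V′ i` (`ℰ = expMeanLogSU`; σ-END takes `V′ =` a
finest translate of `V`): loop-variable bounds `κ₀∕ℓ_i²` on both towers with `κ₀ < δ_N` (κ-chain) and loop-variable VARIATION bounds `κ₁∕ℓ_i³`
(σ-L1 × σ-L2 × σ-L3), `ℓ_i = L^(K−1−i)`, give the correction-factor variation letter `(9∕4·κ₁)∕ℓ_i³` at every level `i < K` and every coarse bond. -/
theorem hκ₁_of_loopHol_le (V V' : GaugeField P 0 (Matrix.specialUnitaryGroup n ℂ)) {κ₀ κ₁ : ℝ} (hκ₀ : κ₀ < deltaSU n)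
    (hloop : ∀ i < P.K, ∀ (c : PBond P (i + 1)) (idx : Idx P),
      dist1 (loopHol (avgTower (expMeanLogSU (n := n)) V i) c idx) ≤ κ₀ / ((P.L : ℝ) ^ (P.K - 1 - i)) ^ 2)
    (hloop' : ∀ i < P.K, ∀ (c : PBond P (i + 1)) (idx : Idx P),
      dist1 (loopHol (avgTower (expMeanLogSU (n := n)) V' i) c idx) ≤ κ₀ / ((P.L : ℝ) ^ (P.K - 1 - i)) ^ 2)
    (hvar : ∀ i < P.K, ∀ (c : PBond P (i + 1)) (idx : Idx P),
      dist1 (loopHol (avgTower (expMeanLogSU (n := n)) V' i) c idx * (loopHol (avgTower (expMeanLogSU (n := n)) V i) c idx)⁻¹)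
        ≤ κ₁ / ((P.L : ℝ) ^ (P.K - 1 - i)) ^ 3) :
    ∀ i < P.K, ∀ c : PBond P (i + 1),
      dist1 (corr (expMeanLogSU (n := n)) (avgTower (expMeanLogSU (n := n)) V' i) c
          * (corr (expMeanLogSU (n := n)) (avgTower (expMeanLogSU (n := n)) V i) c)⁻¹)
        ≤ (9 / 4 * κ₁) / ((P.L : ℝ) ^ (P.K - 1 - i)) ^ 3 := by
  intro i hi c
  have hℓ : (1 : ℝ) ≤ (P.L : ℝ) ^ (P.K - 1 - i) := one_le_pow₀ (by exact_mod_cast P.L_pos)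
  have hκ₀0 : 0 ≤ κ₀ := by
    have h2 : (0 : ℝ) < ((P.L : ℝ) ^ (P.K - 1 - i)) ^ 2 := by positivity
    simpa using (le_div_iff₀ h2).1 ((GaugeGroup.dist1_nonneg _).trans (hloop i hi c (Classical.arbitrary (Idx P))))
  have hρ : κ₀ / ((P.L : ℝ) ^ (P.K - 1 - i)) ^ 2 < deltaSU n :=
    lt_of_le_of_lt (div_le_self hκ₀0 (by nlinarith)) hκ₀
  rw [mul_div_assoc]
  exact dist1_corr_mul_inv_le _ c _ c hρ (hloop i hi c) (hloop' i hi c) (hvar i hi c)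

end Tower

end Summit.QuantumFields.BalabanUV.T4Continuum.B13AvgCorrEmlVariation

end
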